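import Literature.NumberTheory.DiophantineGeometry.MinimalModelStepElevenProofs
import Literature.NumberTheory.DiophantineGeometry.TateAlgorithmIstarEvalProofs
import HarnessLib

/-!
# Tate's algorithm certifies minimality: an exit at Steps 2–10 forces a minimal equation

`Proofs` file (theorems only, no definitions, no named facts) in topic
`NumberTheory/DiophantineGeometry`, companion of `TateAlgorithm`, `TateAlgorithmInvarianceProofs`,
`MinimalModelStepElevenProofs` and `TateAlgorithmIstarEvalProofs`.

Silverman, *Advanced Topics in the Arithmetic of Elliptic Curves*, IV.9.4 runs on an ARBITRARY
integral Weierstrass equation and reaches Step 11 ("the equation was not minimal; divide by `π`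
and restart") exactly when the equation is not minimal (Remark after the algorithm and the proof
of Step 11, PDF pp. 346, 354–355: if some `u = 1` change over `R` achieves
`π ∣ a₁, π² ∣ a₂, π³ ∣ a₃, π⁴ ∣ a₄, π⁶ ∣ a₆` the equation is not minimal, and conversely a
non-minimal integral equation admits such a change — Silverman, *AEC* VII.1.3(b): the `r, s, t`
of a change between integral equations with `v(u) ≤ 1` are integral).  The tree's literal
implementation `WeierstrassCurve.kodairaSymbolOfMinimal` returns the junk `I₀` of its last
branch in that situation (`WeierstrassCurve.kodairaSymbolOfMinimal_eq_I_zero_of_pow_dvd`,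
`MinimalModelStepElevenProofs`).  Reading this contrapositively gives the **minimality test used
in practice**: *if the literal algorithm run on an `R`-integral equation `N` with `Δ ≠ 0`
returns anything other than `I₀`, then `N` is a minimal equation* — so an explicit model on which
one of the forward-evaluation lemmas (`kodairaSymbolOfMinimal_eq_II_of_step2`, `…_IIstar_of_step9`,
`kodairaSymbolOfMinimal_familyA/B`, …) fires is automatically minimal, and its Kodaira symbol is
THE Kodaira symbol of the curve (`WeierstrassCurve.kodairaSymbol_baseChange_eq_of_ne_I_zero`).

## Main results (any DVR `R` with perfect residue field, fraction field `K`)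

* `WeierstrassCurve.isMinimal_baseChange_of_kodairaSymbolOfMinimal_ne_I_zero` — `N` over `R`
  with `kodairaSymbolOfMinimal N ≠ I₀` is minimal (`(N ⊗ K).IsMinimal R`);
* `WeierstrassCurve.kodairaSymbol_baseChange_eq_of_ne_I_zero` — then
  `(N ⊗ K).kodairaSymbol R = N.kodairaSymbolOfMinimal`;
* `WeierstrassCurve.kodairaSymbol_eq_of_smul_eq_baseChange_of_ne_I_zero` — and for any `X / K`
  with `C • X = N ⊗ K`, `X.kodairaSymbol R = N.kodairaSymbolOfMinimal`.

## References

* J. H. Silverman, *Advanced Topics in the Arithmetic of Elliptic Curves*, GTM 151 (1994), IV.9.4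
  Steps 1–11 (PDF pp. 344–346) and the proof of Step 11 (PDF pp. 354–355). [SilvermanATAEC1994]
* J. H. Silverman, *The Arithmetic of Elliptic Curves*, 2nd ed. (2009), Prop. VII.1.3(b)
  (PDF pp. 165–166). [SilvermanAEC2009]
-/

open IsDedekindDomain

namespace WeierstrassCurve

open Literature.NumberTheory.DiophantineGeometry
  Literature.NumberTheory.DiophantineGeometry.TateAlgorithm

variable {R : Type*} [CommRing R] [IsDomain R] [IsDiscreteValuationRing R]
  {K : Type*} [Field K] [Algebra R K] [IsFractionRing R K]

open IsDiscreteValuationRing IsDedekindDomain.HeightOneSpectrum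

/-- In the value group of a DVR an element of valuation `< 1` has valuation `≤ exp (-1)`.
[folklore] -/
private theorem valuation_maximalIdeal_le_exp_neg_one_of_lt_one {x : K}
    (hx : valuation K (IsDiscreteValuationRing.maximalIdeal R) x < 1) :
    valuation K (IsDiscreteValuationRing.maximalIdeal R) x ≤ WithZero.exp (-1 : ℤ) := by
  obtain ⟨a, rfl⟩ := IsDiscreteValuationRing.exists_lift_of_le_one (A := R) hx.le
  rw [valuation_of_algebraMap] at hx ⊢
  have hmem : a ∈ (IsDiscreteValuationRing.maximalIdeal R).asIdeal :=
    (intValuation_lt_one_iff_mem _ a).mp hx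
  have h := (intValuation_le_pow_iff_mem (IsDiscreteValuationRing.maximalIdeal R) a 1).mpr
    (by rwa [pow_one])
  simpa using h

/-- `v (algebraMap a) ≤ exp (-i)` gives `πⁱ ∣ a` (`π` the chosen uniformiser). [folklore] -/
private theorem uniformizer_pow_dvd_of_valuation_algebraMap_le {a : R} {i : ℕ}
    (h : valuation K (IsDiscreteValuationRing.maximalIdeal R) (algebraMap R K a) ≤
      WithZero.exp (-(i : ℤ))) :
    uniformizer R ^ i ∣ a := by
  rw [valuation_of_algebraMap, intValuation_le_pow_iff_mem] at h
  exact mem_maximalIdeal_pow_iff_dvd.mp h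

/-- **A non-minimal integral equation can be brought into the shape of Step 11.**  If `N` has
coefficients in `R` and `N ⊗ K` is NOT a minimal equation, then some change of
variables `T = (1; r, s, t)` over `R` gives `π ∣ a₁, π² ∣ a₂, π³ ∣ a₃, π⁴ ∣ a₄, π⁶ ∣ a₆` on
`T • N`: Mathlib's `IsMinimal` provides `C = (u; r, s, t)` over `K` with `C • (N ⊗ K)` integral
and `v(u) < 1`; then `r, s, t ∈ R` (Silverman, *AEC* VII.1.3(b) under `v(u) ≤ 1`,
`valuation_r/s/t_le_one_of_isIntegral_of_le`) and `aᵢ((1;r,s,t) • N) = uⁱ aᵢ(C • N)` is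
divisible by `πⁱ`.  Silverman *ATAEC* IV.9.4 Step 11 (PDF pp. 346, 354–355).
[cite: SilvermanATAEC1994, IV.9.4 Step 11 (PDF pp. 346, 354–355)]
[cite: SilvermanAEC2009, VII.1 Prop. 1.3(b) (PDF p. 165)] -/
theorem exists_variableChange_pow_dvd_of_not_isMinimal (N : WeierstrassCurve R)
    (hN : ¬ (N.baseChange K).IsMinimal R) :
    ∃ T : VariableChange R, T.u = 1 ∧ uniformizer R ∣ (T • N).a₁ ∧
      uniformizer R ^ 2 ∣ (T • N).a₂ ∧ uniformizer R ^ 3 ∣ (T • N).a₃ ∧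
      uniformizer R ^ 4 ∣ (T • N).a₄ ∧ uniformizer R ^ 6 ∣ (T • N).a₆ := by
  classical
  set X := N.baseChange K with hX
  haveI hint : IsIntegral R X := ⟨⟨N, rfl⟩⟩
  -- unfold Mathlib's `IsMinimal`
  have hN' : ¬ (∀ C : VariableChange K, IsIntegral R (C • X) →
      valuation_Δ_aux R (C • X) ≤ valuation_Δ_aux R ((1 : VariableChange K) • X)) := by
    intro h
    exact hN ⟨⟨by simpa using hint, fun C hC _ ↦ by simpa using h C hC⟩⟩
  push Not at hN'
  obtain ⟨C, hC, hlt⟩ := hN'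
  haveI : IsIntegral R (C • X) := hC
  rw [one_smul] at hlt
  have hlt₀ : (valuation_Δ_aux R X : WithZero (Multiplicative ℤ)) < valuation_Δ_aux R (C • X) := by
    exact_mod_cast hlt
  rw [valuation_Δ_aux_eq_of_isIntegral, valuation_Δ_aux_eq_of_isIntegral] at hlt₀
  have hlt' := hlt₀
  rw [variableChange_Δ, map_mul, map_pow, map_units_inv] at hlt'
  set v := valuation K (IsDiscreteValuationRing.maximalIdeal R) with hv
  have hΔX : X.Δ = algebraMap R K N.Δ := by rw [hX, baseChange, map_Δ]
  -- `v(u) < 1`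
  have hu1 : v (C.u : K) < 1 := by
    by_contra hge
    rw [not_lt] at hge
    have hu0' : 0 < v (C.u : K) :=
      zero_lt_iff.mpr ((Valuation.ne_zero_iff _).mpr (Units.ne_zero _))
    have hinv : (v (C.u : K))⁻¹ ^ 12 ≤ 1 := pow_le_one₀ zero_le ((inv_le_one₀ hu0').mpr hge)
    have : (v (C.u : K))⁻¹ ^ 12 * v X.Δ ≤ v X.Δ := by
      calc (v (C.u : K))⁻¹ ^ 12 * v X.Δ ≤ 1 * v X.Δ := mul_le_mul_left hinv _
        _ = v X.Δ := one_mul _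
    exact absurd hlt' (not_lt.mpr this)
  have hu : v (C.u : K) ≤ 1 := hu1.le
  have hue : v (C.u : K) ≤ WithZero.exp (-1 : ℤ) :=
    valuation_maximalIdeal_le_exp_neg_one_of_lt_one hu1
  -- `r, s, t ∈ R`
  have hr := valuation_r_le_one_of_isIntegral_of_le R (W₁ := X) (W₂ := C • X) rfl hu
  have hs := valuation_s_le_one_of_isIntegral_of_le R (W₁ := X) (W₂ := C • X) rfl hu hr
  have ht := valuation_t_le_one_of_isIntegral_of_le R (W₁ := X) (W₂ := C • X) rfl hu hr
  obtain ⟨r₀, hr₀⟩ := IsDiscreteValuationRing.exists_lift_of_le_one (A := R) hr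
  obtain ⟨s₀, hs₀⟩ := IsDiscreteValuationRing.exists_lift_of_le_one (A := R) hs
  obtain ⟨t₀, ht₀⟩ := IsDiscreteValuationRing.exists_lift_of_le_one (A := R) ht
  set T : VariableChange R := ⟨1, r₀, s₀, t₀⟩ with hT
  have hTK : T.map (algebraMap R K) = (⟨1, C.r, C.s, C.t⟩ : VariableChange K) := by
    ext <;> simp [hT, VariableChange.map, hr₀, hs₀, ht₀]
  have hTN : (T • N).map (algebraMap R K) = (⟨1, C.r, C.s, C.t⟩ : VariableChange K) • X := by
    rw [← map_variableChange, hTK, hX, baseChange]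
  have hfac : C • X = (⟨C.u, 0, 0, 0⟩ : VariableChange K) • (T • N).map (algebraMap R K) := by
    rw [hTN, smul_eq_rescale_smul C X]
  -- `πⁱ ∣ aᵢ (T • N)`
  have hexp : ∀ i : ℕ, (WithZero.exp (-1 : ℤ)) ^ i = WithZero.exp (-(i : ℤ)) := by
    intro i; rw [← WithZero.exp_nsmul]; congr 1; simp
  have key : ∀ (i : ℕ) {a : R} {b : K}, b = ((C.u⁻¹ : Kˣ) : K) ^ i * algebraMap R K a →
      v b ≤ 1 → uniformizer R ^ i ∣ a := by
    intro i a b hb hb1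
    apply uniformizer_pow_dvd_of_valuation_algebraMap_le (K := K)
    have ha : algebraMap R K a = (C.u : K) ^ i * b := by
      rw [hb, ← mul_assoc, ← mul_pow, Units.mul_inv, one_pow, one_mul]
    rw [← hv]
    calc v (algebraMap R K a) = v (C.u : K) ^ i * v b := by rw [ha, map_mul, map_pow]
      _ ≤ v (C.u : K) ^ i := mul_le_of_le_one_right' hb1
      _ ≤ (WithZero.exp (-1 : ℤ)) ^ i := pow_le_pow_left' hue i
      _ = WithZero.exp (-(i : ℤ)) := hexp i
  have int₁ : v (C • X).a₁ ≤ 1 := by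
    rw [← integralModel_a₁_eq R (C • X)]; exact valuation_le_one _ _
  have int₂ : v (C • X).a₂ ≤ 1 := by
    rw [← integralModel_a₂_eq R (C • X)]; exact valuation_le_one _ _
  have int₃ : v (C • X).a₃ ≤ 1 := by
    rw [← integralModel_a₃_eq R (C • X)]; exact valuation_le_one _ _
  have int₄ : v (C • X).a₄ ≤ 1 := by
    rw [← integralModel_a₄_eq R (C • X)]; exact valuation_le_one _ _
  have int₆ : v (C • X).a₆ ≤ 1 := by
    rw [← integralModel_a₆_eq R (C • X)]; exact valuation_le_one _ _
  refine ⟨T, rfl, ?_, ?_, ?_, ?_, ?_⟩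
  · have := key 1 (a := (T • N).a₁) (b := (C • X).a₁)
      (by rw [hfac, rescale_a₁, map_a₁, pow_one]) int₁
    rwa [pow_one] at this
  · exact key 2 (a := (T • N).a₂) (b := (C • X).a₂) (by rw [hfac, rescale_a₂, map_a₂]) int₂
  · exact key 3 (a := (T • N).a₃) (b := (C • X).a₃) (by rw [hfac, rescale_a₃, map_a₃]) int₃
  · exact key 4 (a := (T • N).a₄) (b := (C • X).a₄) (by rw [hfac, rescale_a₄, map_a₄]) int₄
  · exact key 6 (a := (T • N).a₆) (b := (C • X).a₆) (by rw [hfac, rescale_a₆, map_a₆]) int₆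

/-- **Tate's algorithm certifies minimality** (perfect residue field): if the literal algorithm
`kodairaSymbolOfMinimal` returns anything other than `I₀` on an `R`-integral equation `N`
— i.e. it exits at one of Steps 2–10 — then `N` is a minimal Weierstrass equation (for `Δ = 0`
every integral equation is minimal in Mathlib's sense anyway).
Contrapositive of Step 11 read forwards (`kodairaSymbolOfMinimal_eq_I_zero_of_pow_dvd`) and of
`exists_variableChange_pow_dvd_of_not_isMinimal`.  Silverman *ATAEC* IV.9.4, Steps 1–11
("If [Step 11 is reached], the original equation was not minimal").
[cite: SilvermanATAEC1994, IV.9.4 Step 11 (PDF pp. 346, 354–355)] -/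
theorem isMinimal_baseChange_of_kodairaSymbolOfMinimal_ne_I_zero
    [PerfectField (IsLocalRing.ResidueField R)] (N : WeierstrassCurve R)
    (hN : N.kodairaSymbolOfMinimal ≠ .I 0) : (N.baseChange K).IsMinimal R := by
  by_contra h
  obtain ⟨T, -, h1, h2, h3, h4, h6⟩ := exists_variableChange_pow_dvd_of_not_isMinimal (K := K) N h
  exact hN (kodairaSymbolOfMinimal_eq_I_zero_of_pow_dvd N T h1 h2 h3 h4 h6)

/-- **The Kodaira symbol read on a model where the algorithm exits.**  If `kodairaSymbolOfMinimal`
does not return `I₀` on the `R`-integral equation `N` (`Δ ≠ 0`), then `N` is minimal and the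
Kodaira symbol of the curve `N ⊗ K` (Tate's algorithm on Mathlib's chosen integral minimal model)
is the value computed on `N`.  Silverman *ATAEC* IV.9.4 with *AEC* VII.1.3(b).
[cite: SilvermanATAEC1994, IV.9.4 (PDF pp. 344–346)] -/
theorem kodairaSymbol_baseChange_eq_of_ne_I_zero [PerfectField (IsLocalRing.ResidueField R)]
    (N : WeierstrassCurve R) (hΔ : N.Δ ≠ 0) (hN : N.kodairaSymbolOfMinimal ≠ .I 0) :
    (N.baseChange K).kodairaSymbol R = N.kodairaSymbolOfMinimal := by
  haveI := isMinimal_baseChange_of_kodairaSymbolOfMinimal_ne_I_zero (K := K) N hN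
  have hΔK : (N.baseChange K).Δ ≠ 0 := by
    rw [baseChange, map_Δ]; exact (map_ne_zero_iff _ (IsFractionRing.injective R K)).mpr hΔ
  rw [kodairaSymbol_eq_kodairaSymbolOfMinimal_of_isMinimal R (N.baseChange K) (N.baseChange K) 1
    (one_smul _ _).symm hΔK,
    WeierstrassCurve.map_injective (IsFractionRing.injective R K)
      (baseChange_integralModel_eq R (N.baseChange K))]

/-- **The Kodaira symbol of a curve read on any `K`-isomorphic integral model where the algorithm
exits**: if `C • X = N ⊗ K` with `N` over `R`, `Δ(N) ≠ 0` and `kodairaSymbolOfMinimal N ≠ I₀`,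
then `X.kodairaSymbol R = N.kodairaSymbolOfMinimal` (model independence of the Kodaira symbol,
`kodairaSymbol_smul_holds`, Tate 1975 §§7–8).  Silverman *ATAEC* IV.9.4.
[cite: SilvermanATAEC1994, IV.9.4 (PDF pp. 344–346)] [cite: Tate1975] -/
theorem kodairaSymbol_eq_of_smul_eq_baseChange_of_ne_I_zero
    [PerfectField (IsLocalRing.ResidueField R)] (X : WeierstrassCurve K) [X.IsElliptic]
    (C : VariableChange K) (N : WeierstrassCurve R) (h : C • X = N.baseChange K) (hΔ : N.Δ ≠ 0)
    (hN : N.kodairaSymbolOfMinimal ≠ .I 0) : X.kodairaSymbol R = N.kodairaSymbolOfMinimal := by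
  rw [← kodairaSymbol_smul_holds R X C, h]
  exact kodairaSymbol_baseChange_eq_of_ne_I_zero N hΔ hN

end WeierstrassCurve
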